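import Literature.Algebra.Homology.ExtOfAcyclicResolutionFunctoriality
import HarnessLib

/-!
# Functoriality of `Extⁿ(X, M) ≅ Hⁿ(Ext⁰(X, I•))` under exact functors — the main squares

Topic `Algebra/Homology`; namespace `Literature.Algebra.Homology.AcyclicResolution`.  Second half of
`ExtOfAcyclicResolutionFunctoriality` (split for the 400-line rule); pure homological algebra, no
named fact, no `sorry`.

For an exact additive functor `F : C ⥤ D` and an exact `Ext(X, –)`-acyclic augmented complex
`0 → M —η→ I•` with `F I•` `Ext(F X, –)`-acyclic, the cochain map `F_* : Ext⁰(X, I•) → Ext⁰(F X, F I•)`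
(`extComplexMapF`) makes the squares

  `Extⁿ_C(X, M)      ≃+  Hⁿ(Ext⁰_C(X, I•))`
  `   | F                    | Hⁿ(F_*)`
  `Extⁿ_D(F X, F M)  ≃+  Hⁿ(Ext⁰_D(F X, F I•))`

commute: `extAddEquivHomologySucc_map` (positive degrees) and `extAddEquivHomologyZero_map`.

## References
* C. A. Weibel, *An introduction to homological algebra*, CUP (1994), §2.4, Thm. 2.7.6. [Weibel1994]
-/

noncomputable section

universe w v v' u u'

namespace Literature.Algebra.Homology

namespace AcyclicResolution

open CategoryTheory CategoryTheory.Limits CategoryTheory.Abelian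

section Functor

variable {C : Type u} [Category.{v} C] [Abelian C] [HasExt.{w} C]
  {D : Type u'} [Category.{v'} D] [Abelian D] [HasExt.{w} D]
  (F : C ⥤ D) [F.Additive] [PreservesFiniteLimits F] [PreservesFiniteColimits F]
  (X : C) (I : CochainComplex C ℕ) {M : C} (η : M ⟶ I.X 0) (hη : η ≫ I.d 0 1 = 0)

-- As in part one: `F η` read as the augmentation `F M ⟶ (F I)⁰` is mono when `F η : F M ⟶ F(I⁰)` is
-- (the targets agree by unfolding `Functor.mapHomologicalComplex`, which is not reducible).
attribute [local instance] mono_map_augmentation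

/-! ## §4 The cochain map `F_* : Ext⁰(X, I•) → Ext⁰(F X, F I•)` and the main squares -/

/-- **The cochain map `F_*`** with components `Ext⁰(X, Iⁿ) → Ext⁰(F X, F Iⁿ)`, `x ↦ F x`.
[cite: Weibel1994, Theorem 2.7.6] -/
def extComplexMapF : extComplex X I ⟶ extComplex (F.obj X) (mapComplex F I) where
  f n := AddCommGrpCat.ofHom (F.mapExtAddHom X (I.X n) 0)
  comm' i j hij := by
    ext x
    change ((x.mapExactFunctor F).comp (Ext.mk₀ ((mapComplex F I).d i j)) (add_zero 0)) =
      (x.comp (Ext.mk₀ (I.d i j)) (add_zero 0)).mapExactFunctor F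
    rw [Ext.mapExactFunctor_comp, Ext.mapExactFunctor_mk₀]
    -- the two sides differ only by the definitional unfolding `(F I)ʲ = F (Iʲ)` of the target of `F (dⁱʲ)`
    rfl

/-- Components of `F_*`. [cite: Weibel1994, Theorem 2.7.6] -/
@[simp]
theorem extComplexMapF_f_apply (n : ℕ) (x : Ext X (I.X n) 0) :
    ((extComplexMapF F X I).f n).hom x = x.mapExactFunctor F := rfl

variable (hex : (ShortComplex.mk η (I.d 0 1) hη).Exact)
  (hI : ∀ n, I.ExactAt (n + 1)) (hX : ∀ n q (e : Ext X (I.X n) (q + 1)), e = 0)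
  (hX' : ∀ n q (e : Ext (F.obj X) ((mapComplex F I).X n) (q + 1)), e = 0)

/-- **Functoriality of `extAddEquivHomologySucc` under an exact functor**: `Hⁿ⁺¹(F_*) ∘ E_I = E_{FI} ∘ F`.
[cite: Weibel1994, Theorem 2.7.6] -/
theorem extAddEquivHomologySucc_map [Mono η] [Mono (F.map η)] (n : ℕ) (x : Ext X M (n + 1)) :
    (HomologicalComplex.homologyMap (extComplexMapF F X I) (n + 1)).hom
        (extAddEquivHomologySucc X I η hη hex hI hX n x) =
      extAddEquivHomologySucc (F.obj X) (mapComplex F I) (F.map η) (map_hη F I η hη)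
        (map_exact_augmentation F I η hη hex) (map_exactAt F I hI) hX' n (x.mapExactFunctor F) := by
  set e5 := ((extComplex X I).homologyIsoSc' n (n + 1) (n + 1 + 1) (CochainComplex.prev_nat_succ n)
      (CochainComplex.next ℕ (n + 1)) ≪≫ ShortComplex.abHomologyIso _) with he5
  set e5' := ((extComplex (F.obj X) (mapComplex F I)).homologyIsoSc' n (n + 1) (n + 1 + 1)
      (CochainComplex.prev_nat_succ n) (CochainComplex.next ℕ (n + 1)) ≪≫
      ShortComplex.abHomologyIso _) with he5'
  apply e5'.addCommGroupIsoToAddEquiv.injective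
  have hnat := homologyMap_concreteOf (extComplexMapF F X I) n (n + 1) (n + 1 + 1)
    (CochainComplex.prev_nat_succ n) (CochainComplex.next ℕ (n + 1))
  have step5 : e5'.addCommGroupIsoToAddEquiv ((HomologicalComplex.homologyMap (extComplexMapF F X I)
      (n + 1)).hom (extAddEquivHomologySucc X I η hη hex hI hX n x)) =
      kerQuotMapOf (extComplexMapF F X I) n (n + 1) (n + 1 + 1) (e5.addCommGroupIsoToAddEquiv
        (extAddEquivHomologySucc X I η hη hex hI hX n x)) := by
    change (HomologicalComplex.homologyMap (extComplexMapF F X I) (n + 1) ≫ e5'.hom).hom _ =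
      (e5.hom ≫ AddCommGrpCat.ofHom (kerQuotMapOf (extComplexMapF F X I) n (n + 1) (n + 1 + 1))).hom _
    rw [hnat]
  rw [step5]
  change kerQuotMapOf (extComplexMapF F X I) n (n + 1) (n + 1 + 1)
      (e5.addCommGroupIsoToAddEquiv (e5.addCommGroupIsoToAddEquiv.symm
      (QuotientAddGroup.congr _ _ (cyclesExtAddEquiv X I n (n + 1) (n + 1 + 1) (CochainComplex.next ℕ (n + 1)))
        (map_cyclesExtAddEquiv_range X I n)
        (extOneQuotientAddEquiv X (cyclesSC_shortExact I n (hI n)) (hX n 0)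
          ((iterShift I X hI hX n (a := 0) (b := n + 1) (by omega)).symm
            (extAddEquivOfIso X (isoCyclesZero I η hη hex) (n + 1) x)))))) =
    e5'.addCommGroupIsoToAddEquiv (e5'.addCommGroupIsoToAddEquiv.symm
      (QuotientAddGroup.congr _ _
        (cyclesExtAddEquiv (F.obj X) (mapComplex F I) n (n + 1) (n + 1 + 1)
          (CochainComplex.next ℕ (n + 1)))
        (map_cyclesExtAddEquiv_range (F.obj X) (mapComplex F I) n)
        (extOneQuotientAddEquiv (F.obj X) (cyclesSC_shortExact (mapComplex F I) n (map_exactAt F I hI n))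
          (hX' n 0)
          ((iterShift (mapComplex F I) (F.obj X) (map_exactAt F I hI) hX' n (a := 0) (b := n + 1)
              (by omega)).symm
            (extAddEquivOfIso (F.obj X) (isoCyclesZero (mapComplex F I) (F.map η) (map_hη F I η hη)
              (map_exact_augmentation F I η hη hex)) (n + 1) (x.mapExactFunctor F))))))
  rw [AddEquiv.apply_symm_apply, AddEquiv.apply_symm_apply]
  have step12 : (iterShift (mapComplex F I) (F.obj X) (map_exactAt F I hI) hX' n (a := 0) (b := n + 1)
        (by omega)).symm
      (extAddEquivOfIso (F.obj X) (isoCyclesZero (mapComplex F I) (F.map η) (map_hη F I η hη)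
        (map_exact_augmentation F I η hη hex)) (n + 1) (x.mapExactFunctor F)) =
      ((((iterShift I X hI hX n (a := 0) (b := n + 1) (by omega)).symm
        (extAddEquivOfIso X (isoCyclesZero I η hη hex) (n + 1) x)).mapExactFunctor F).comp
          (Ext.mk₀ (cyclesIsoF F I n).hom) (add_zero _)) := by
    rw [← extAddEquivOfIso_isoCyclesZero_map F X I η hη hex, iterShift_symm_map F X I hI hX hX']
  rw [step12]
  set y := (iterShift I X hI hX n (a := 0) (b := n + 1) (by omega)).symm
    (extAddEquivOfIso X (isoCyclesZero I η hη hex) (n + 1) x) with hy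
  have step3 := extOneQuotientAddEquiv_map F X I n (hI n) (cyclesSC_shortExact I n (hI n))
    (cyclesSC_shortExact (mapComplex F I) n (map_exactAt F I hI n)) (hX n 0) (hX' n 0) y
  rw [← step3]
  obtain ⟨z, hz⟩ := QuotientAddGroup.mk_surjective
    (extOneQuotientAddEquiv X (cyclesSC_shortExact I n (hI n)) (hX n 0) y)
  rw [← hz]
  change QuotientAddGroup.mk (kerMapOf (extComplexMapF F X I) n (n + 1) (n + 1 + 1)
      (cyclesExtAddEquiv X I n (n + 1) (n + 1 + 1) (CochainComplex.next ℕ (n + 1)) z)) =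
    QuotientAddGroup.mk (cyclesExtAddEquiv (F.obj X) (mapComplex F I) n (n + 1) (n + 1 + 1)
      (CochainComplex.next ℕ (n + 1))
      ((z.mapExactFunctor F).comp (Ext.mk₀ (cyclesIsoF F I (n + 1)).hom) (add_zero 0)))
  congr 1
  apply Subtype.ext
  rw [kerMapOf_apply_val, cyclesExtAddEquiv_map]
  rfl

/-- **Functoriality of `extAddEquivHomologyZero` under an exact functor.** [cite: Weibel1994, Theorem 2.7.6] -/
theorem extAddEquivHomologyZero_map [Mono η] [Mono (F.map η)] (x : Ext X M 0) :
    (HomologicalComplex.homologyMap (extComplexMapF F X I) 0).hom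
        (extAddEquivHomologyZero X I η hη hex x) =
      extAddEquivHomologyZero (F.obj X) (mapComplex F I) (F.map η) (map_hη F I η hη)
        (map_exact_augmentation F I η hη hex) (x.mapExactFunctor F) := by
  set e5 := ((extComplex X I).homologyIsoSc' 0 0 1 CochainComplex.prev_nat_zero
      (CochainComplex.next ℕ 0) ≪≫ ShortComplex.abHomologyIso _) with he5
  set e5' := ((extComplex (F.obj X) (mapComplex F I)).homologyIsoSc' 0 0 1 CochainComplex.prev_nat_zero
      (CochainComplex.next ℕ 0) ≪≫ ShortComplex.abHomologyIso _) with he5'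
  apply e5'.addCommGroupIsoToAddEquiv.injective
  have hnat := homologyMap_concreteOf (extComplexMapF F X I) 0 0 1 CochainComplex.prev_nat_zero
    (CochainComplex.next ℕ 0)
  have step5 : e5'.addCommGroupIsoToAddEquiv ((HomologicalComplex.homologyMap (extComplexMapF F X I)
      0).hom (extAddEquivHomologyZero X I η hη hex x)) =
      kerQuotMapOf (extComplexMapF F X I) 0 0 1 (e5.addCommGroupIsoToAddEquiv
        (extAddEquivHomologyZero X I η hη hex x)) := by
    change (HomologicalComplex.homologyMap (extComplexMapF F X I) 0 ≫ e5'.hom).hom _ =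
      (e5.hom ≫ AddCommGrpCat.ofHom (kerQuotMapOf (extComplexMapF F X I) 0 0 1)).hom _
    rw [hnat]
  rw [step5]
  change kerQuotMapOf (extComplexMapF F X I) 0 0 1 (e5.addCommGroupIsoToAddEquiv
      (e5.addCommGroupIsoToAddEquiv.symm
      (QuotientAddGroup.quotientAddEquivOfEq (abToCycles_zero_range_eq_bot X I).symm
        (QuotientAddGroup.quotientBot.symm
          (cyclesExtAddEquiv X I 0 0 1 (CochainComplex.next ℕ 0)
            (extAddEquivOfIso X (isoCyclesZero I η hη hex) 0 x)))))) =
    e5'.addCommGroupIsoToAddEquiv (e5'.addCommGroupIsoToAddEquiv.symm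
      (QuotientAddGroup.quotientAddEquivOfEq
        (abToCycles_zero_range_eq_bot (F.obj X) (mapComplex F I)).symm
        (QuotientAddGroup.quotientBot.symm
          (cyclesExtAddEquiv (F.obj X) (mapComplex F I) 0 0 1 (CochainComplex.next ℕ 0)
            (extAddEquivOfIso (F.obj X) (isoCyclesZero (mapComplex F I) (F.map η) (map_hη F I η hη)
              (map_exact_augmentation F I η hη hex)) 0 (x.mapExactFunctor F))))))
  rw [AddEquiv.apply_symm_apply, AddEquiv.apply_symm_apply,
    ← extAddEquivOfIso_isoCyclesZero_map F X I η hη hex]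
  change QuotientAddGroup.mk (kerMapOf (extComplexMapF F X I) 0 0 1 (cyclesExtAddEquiv X I 0 0 1
      (CochainComplex.next ℕ 0) (extAddEquivOfIso X (isoCyclesZero I η hη hex) 0 x))) =
    QuotientAddGroup.mk (cyclesExtAddEquiv (F.obj X) (mapComplex F I) 0 0 1 (CochainComplex.next ℕ 0)
      (((extAddEquivOfIso X (isoCyclesZero I η hη hex) 0 x).mapExactFunctor F).comp
        (Ext.mk₀ (cyclesIsoF F I 0).hom) (add_zero 0)))
  congr 1
  apply Subtype.ext
  rw [kerMapOf_apply_val, cyclesExtAddEquiv_map]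
  rfl

end Functor

end AcyclicResolution

end Literature.Algebra.Homology
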